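import Summits.QuantumFields.BalabanUV.T4Continuum.Support.SubstrateAvgTowerStructure
import Summits.QuantumFields.BalabanUV.T4Continuum.Support.SubstrateTransporterSpecies
import Summits.QuantumFields.BalabanUV.T4Continuum.Support.NE2FromNE3BavgBridge
import Summits.QuantumFields.BalabanUV.T4Continuum.Spine.NE2BalabanGauge

/-!
# SUBSTRATE — W-25a = L-E19 PART 2 (plumbing half, (S3) + the scalar tower): `towerOfS` (the scalar transporter tower of a run, read by NE5's
# `RgV`) TIED to `towerOf` ∕ `towerDataOf`, the direct representation AFTER `ι`, and the plumbing of the four regularity letters (ℓ1)–(ℓ4) into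
# the binders `hreg` ∕ `hloc` of NE5's W1 chain TOKEN FOR TOKEN (typer (ο10) l.23046 ∕ (π2) l.23183 «THIS SHAPE», riders (σ1)–(σ4); t4-dagwriter Q49)

Cell `pub-balaban`, SUBSTRATE cell, seat `b2b-balaban-substrate-p3` (gen 4).  Summits-side under the LEAN PLACEMENT RULE ([dict] ∕ [folklore] bookkeeping;
nothing printed is asserted; no citation tags; no `Prop`-valued fact minted).  Follower of PART 1 `SubstrateAvgTowerStructure` (the identity
`avgTower_eq_corrAcc_mul_axialTower` and its `dist1` bookkeeping), of p217365 `SubstrateBackgroundTransporters` (`towerOf`, `transS`, `siteIdx`), p220490∕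
`SubstrateTransporterSpecies` (`towerDataOf`), row NE2's `NE2FromNE3BavgBridge.localRate_regClass_of_bavg_consistent` and `Spine.NE2BalabanGauge.liftR`
(import precedent: `B13ReadingsRecordRate`) BY NAME; nothing restated.

WHAT.  §3 THE SCALAR TOWER (V2): **`towerOfS P ι U`** (scalar twin of p217365's `towerOf`: `transS ∘ siteIdx` level by level, `1` beyond `K` — the shape of
NE5's `RgV V : (k : ℕ) → Fin d → (Tor (fine (lev L k) M) → M_o(ℂ))`), admitted WITH ITS TWO TIES (rider (σ1): extend, never duplicate): **`liftR_towerOfS`**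
(`liftR P.L (unitMod P) (towerOfS P ι U) = towerOf P ι U`, rfl per level) and **`towerOfS_avgTower_eq_towerDataOf`** (`liftR … (towerOfS P ι (avgTower ℰ V)) k =
towerDataOf P ι (fun _ => blockAvg ℰ) V k` on `k : Fin (K+1)` — ONE object for W-20∕W-22′'s `towerB` and NE5's `RgV`; generic form `towerOf_iter_eq_towerDataOf`);
`towerOfS_chart`; the direct representation AFTER `ι`: **`towerOfS_avgTower_chart`** (`towerOfS P ι (avgTower ℰ V) k ν (e x) = ι (corrAcc …) * ι ((axial)^j V …)`),
**`towerOfS_avgTower_chart_succ`** (ONE STEP: `= ι (corr ℰ U_j c) * ι (Π_{t<L} U_j (line c t))` — the NE5 owner's `hstruct` letter `R k μ i = C * lprod (…) L`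
at the datum, modulo the line-site junction of W-25b), `iota_pathProd_eq_list_prod` (ordered `List` product — the junction to `lprod`).
§4 THE PLUMBING (S3): **`hreg_hloc_of_letters`** — for ANY scalar-tower family `RgV`, per-`V ∈ dom` (ℓ1) + (ℓ2) `hlipD` + (ℓ3) `hbavg` + (ℓ4) `hbavgD` ⟹ the
PAIR `hreg ∧ hloc` of g38-c ∕ W-21c TOKEN FOR TOKEN, `C := γ + 2d·max β βD`, `θ := L⁻¹` (ONE `exact` of NE2's lemma per `V`; (ℓ2)(ℓ4) DISPLAYED — row NE2
ROOT-B per Q49 (b)); **`hreg_hloc_avgTower`** — the same at `RgV := fun b => towerOfS P ι (avgTower ℰ (fld b))` over any window `dom : Set BgD` read through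
`fld : BgD → GaugeField P 0 G` (the E-avg instance's binder supplier; its (ℓ1)(ℓ3) inputs are W-25b's conclusions, ON EVENT g39-a).
§5 THE TOP-LEVEL CAVEAT (a LOCATED junction fact, kernel): at a `towerOf`-padded tower (levels `k > K` read `1`, p217365 `towerOf_of_lt`) the `∀ k`
letters (ℓ3)(ℓ4) and the binder `hloc` compare, at `k = K`, the finest connection `w_K = L^K(ι V − 1)` with the junk level `K + 1` (connection `0`):
**`norm_connTower_top_le_of_hbavg`** (`hbavg` ⟹ `‖w_K(y)‖ ≤ γ∕L^K`), **`norm_connTower_top_le_of_localRate(')`** (`hloc` ⟹ `‖w_K(i)‖ ≤ 2|o|C∕L^K` at EVERY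
top-level index), **`finest_small_of_hloc`** (V1 words: `L^K·‖ι (U₀ b) − 1‖ ≤ 2|o|C∕L^K` for EVERY finest bond) — so §4's hypotheses `h3`∕`h4` and the
conclusion `hloc` are satisfiable by a padded tower ONLY for finest fields within `2|o|C·L^{−2K}` of `1`; consumers need the letters on a LEVEL WINDOW
(`k + 1 ≤ K`: both levels physical) — recorded for the NE5 ∕ NE2 owners and the typer (journal LOCATED note of this seat), not repaired here.

HONEST FRAMING: rung (B)+1 of the FINITE-VOLUME T⁴ programme — NOT infinite volume, NOT a mass gap, NOT Clay; spine PROVED 0∕9; NE5 ∕ NE2 NOT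
PRINTED ∕ NOT PROVED; substrate = data + structural lemmas + bookkeeping, NO estimate of any NE row (κ displayed, discharge = NE5 lineage per
Q49 (a′); (ℓ2)(ℓ4) displayed); §5 states a located VACUITY of the `∀ k` letters at padded towers — a fact about OUR typed objects, asserting nothing
about Bałaban; nothing of [Balaban1985Averaging] ∕ [Balaban1987RG1] is discharged.  HONEST DEPENDENCY (cell line, verbatim): continuum
YM on T⁴ ⇐ BetaPertH ∧ nine spine estimates (0/9 proved); BetaPertH ⇐ (D1) ∧ (D4) ∧ CAP+tail; G-an2-4 gates asym, D1 and NE2/3/4.  0 sorry; axioms ⊆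
{propext, Classical.choice, Quot.sound}.
-/

noncomputable section

open scoped BigOperators Matrix Matrix.Norms.L2Operator

namespace Summit.QuantumFields.BalabanUV.T4Continuum.SubstrateAvgTowerPlumbing

open Literature.MathematicalPhysics.QuantumFieldTheory.Balaban1983to89
open Literature.MathematicalPhysics.QuantumFieldTheory.Balaban1983to89.B5Prop11Plancherel (Tor fine)
open Literature.MathematicalPhysics.QuantumFieldTheory.Balaban1983to89.B5G183RateUnitTower (lev lev_neZero)
open Literature.MathematicalPhysics.QuantumFieldTheory.Balaban1983to89.T4EtaRateMin (LocalRate)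
open Literature.MathematicalPhysics.QuantumFieldTheory.Balaban1983to89.BlockAveraging (corr avgFun blockAvg)
open Literature.MathematicalPhysics.QuantumFieldTheory.Balaban1983to89.AveragingRT (line pathProd axialAvg axial)
open Summit.QuantumFields.BalabanUV.T4Continuum
open Summit.QuantumFields.BalabanUV.T4Continuum.BalabanAveragedTowerUnit (idx)
open Literature.MathematicalPhysics.QuantumFieldTheory.Balaban1983to89.B5G183RateTorus (cpt)
open Literature.MathematicalPhysics.QuantumFieldTheory.Balaban1983to89.B5G183RateTorusW (off)
open Summit.QuantumFields.BalabanUV.T4Continuum.BalabanAveragedTowerUnit (lev_succ' cast_lev' one_le_lev')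
open Summit.QuantumFields.BalabanUV.T4Continuum.BalabanAveragedTowerModes (par_cpt_add_off)
open Summit.QuantumFields.BalabanUV.T4Continuum.BlockPairingGeometry (tau parT)
open Summit.QuantumFields.BalabanUV.T4Continuum.CovariantLinePlanting (bavg)
open Summit.QuantumFields.BalabanUV.T4Continuum.NE2FromNE3 (bgReadings consistent_of_localRate_lev)
open Summit.QuantumFields.BalabanUV.T4Continuum.RegularBackgroundTower (RegularTransporters connTower dconnTower regClass connTower_eq)
open Summit.QuantumFields.BalabanUV.T4Continuum.NE2FromNE3BavgBridge (localRate_regClass_of_bavg_consistent)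
open Summit.QuantumFields.BalabanUV.T4Continuum.NE2BalabanGauge (liftR liftR_apply)
open Summit.QuantumFields.BalabanUV.T4Continuum.SubstrateBackgroundTransporters (unitMod siteIdx transS transV towerOf towerOf_of_le towerOf_of_lt
  transV_eq_transS towerOf_chart norm_lev)
open Summit.QuantumFields.BalabanUV.T4Continuum.SubstrateTransporterSpecies (TowerData towerDataOf)
open Summit.QuantumFields.BalabanUV.T4Continuum.SubstrateAvgTowerStructure

/-! ## §3 The scalar transporter tower read by NE5's `RgV`, and its identification with `towerOf` ∕ `towerDataOf` -/

section Scalar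

variable (P : Params) {G : Type*} [GaugeGroup G] {o : Type*} [Fintype o] [DecidableEq o] (ι : G →* Matrix o o ℂ)

/-- [folklore] **THE SCALAR TRANSPORTER TOWER OF A RUN** (the scalar twin of p217365's `towerOf`): at NE2 level `k ≤ K` the site-based transporters
`x ↦ ι (U_{K−k}(x, x + e_ν))` in the level-`k` chart, `1` beyond `K` — the shape of NE5's `RgV V : (k : ℕ) → Fin d → (Tor (fine (lev L k) M) → M_o(ℂ))`. -/
def towerOfS (U : (j : ℕ) → GaugeField P j G) (k : ℕ) : Fin P.d → (Tor (fine (lev P.L k) (unitMod P)) → Matrix o o ℂ) :=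
  if h : k ≤ P.K then transS (siteIdx P (j := P.K - k) (k := k) (by omega)) ι (U (P.K - k)) else fun _ _ => 1

variable {P}

/-- [folklore] In range: level `k ≤ K` reads `U (K − k)`. -/ theorem towerOfS_of_le (U : (j : ℕ) → GaugeField P j G) {k : ℕ} (h : k ≤ P.K) :
    towerOfS P ι U k = transS (siteIdx P (j := P.K - k) (k := k) (by omega)) ι (U (P.K - k)) := by
  rw [towerOfS, dif_pos h]

/-- [folklore] Out of range: levels `k > K` are `1`. -/ theorem towerOfS_of_lt (U : (j : ℕ) → GaugeField P j G) {k : ℕ} (h : P.K < k) : towerOfS P ι U k = fun _ _ => 1 := by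
  rw [towerOfS, dif_neg (not_le.mpr h)]

/-- [folklore] In the chart's coordinates: `towerOfS P ι U k ν (e x) = ι (U_{K−k}(x, x + e_ν))`. -/
theorem towerOfS_chart (U : (j : ℕ) → GaugeField P j G) {k : ℕ} (h : k ≤ P.K) (ν : Fin P.d) (x : Site P (P.K - k)) :
    towerOfS P ι U k ν (siteIdx P (j := P.K - k) (k := k) (by omega) x) = ι (U (P.K - k) ⟨x, ν⟩) := by
  rw [towerOfS_of_le ι U h, SubstrateBackgroundTransporters.transS_apply, Equiv.symm_apply_apply]

/-- [folklore] **LIFTING THE SCALAR TOWER GIVES THE VECTOR TOWER OF RECORD**: `liftR P.L (unitMod P) (towerOfS P ι U) = towerOf P ι U` (component-blind,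
`transV_eq_transS`; rfl per level). -/
theorem liftR_towerOfS (U : (j : ℕ) → GaugeField P j G) : liftR P.L (unitMod P) (towerOfS P ι U) = towerOf P ι U := by
  funext k ν i
  rw [liftR_apply]
  rcases le_or_gt k P.K with h | h
  · rw [towerOfS_of_le ι U h, towerOf_of_le ι U h, transV_eq_transS]
  · rw [towerOfS_of_lt ι U h, towerOf_of_lt ι U h]

/-- [folklore] **THE TOWER OF AN ITERATED AVERAGING IS THE TOWER DATA OF RECORD**: for any family of one-step averagings `av`,
`towerOf P ι (fun j => Averaging.iter av j V) k = towerDataOf P ι av V k` on the levels `k : Fin (K+1)` (same formula; W-20∕W-22′'s `towerB` and the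
`RegularTransporters` tower are ONE object). -/
theorem towerOf_iter_eq_towerDataOf (av : ∀ j, Averaging P j G) (V : GaugeField P 0 G) (k : Fin (P.K + 1)) :
    towerOf P ι (fun j => Averaging.iter av j V) k = towerDataOf P ι av V k := by
  rw [towerOf_of_le ι _ (Nat.le_of_lt_succ k.2)]
  rfl

/-- [folklore] **RIDER (σ1)'s SECOND TIE**: `liftR (towerOfS (avgTower ℰ V)) k = towerDataOf P ι (fun _ => blockAvg ℰ) V k` on `Fin (K+1)` — the scalar
averaging tower, lifted, IS W-20∕W-22′'s `towerB` datum. -/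
theorem towerOfS_avgTower_eq_towerDataOf (ℰ : LoopAverage G) (V : GaugeField P 0 G) (k : Fin (P.K + 1)) :
    liftR P.L (unitMod P) (towerOfS P ι (avgTower ℰ V)) k = towerDataOf P ι (fun i => (blockAvg ℰ : Averaging P i G)) V k := by
  rw [liftR_towerOfS]
  exact towerOf_iter_eq_towerDataOf ι _ V k

/-- [folklore] **THE DIRECT REPRESENTATION AFTER `ι`**: in the chart, `towerOfS P ι (avgTower ℰ V) k ν (e x) = ι (corrAcc ℰ V (K−k) ⟨x,ν⟩) · ι ((axial)^{K−k} V ⟨x,ν⟩)`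
— the letters `C` and `S` of the NE5 owner's abstract lemma, AT THE DATUM. -/
theorem towerOfS_avgTower_chart (ℰ : LoopAverage G) (V : GaugeField P 0 G) {k : ℕ} (h : k ≤ P.K) (ν : Fin P.d) (x : Site P (P.K - k)) :
    towerOfS P ι (avgTower ℰ V) k ν (siteIdx P (j := P.K - k) (k := k) (by omega) x) =
      ι (corrAcc ℰ V (P.K - k) ⟨x, ν⟩) * ι (axialTower V (P.K - k) ⟨x, ν⟩) := by
  rw [towerOfS_chart ι _ h, avgTower_eq_corrAcc_mul_axialTower, map_mul]

/-- [folklore] a path product after `ι` is an ordered `List` product (`map_list_prod` shape) — the junction to a `lprod`-type letter. -/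
theorem iota_pathProd_eq_list_prod {j : ℕ} (U : GaugeField P j G) (c : PBond P (j + 1)) (n : ℕ) :
    ι (pathProd U c n) = ((List.range n).map fun t => ι (U (line c t))).prod := by
  induction n with
  | zero => rw [List.range_zero, List.map_nil, List.prod_nil]; exact map_one ι
  | succ n ih =>
      rw [List.range_succ, List.map_append, List.prod_append, List.map_singleton, List.prod_singleton, ← ih, ← map_mul]
      rfl

/-- [folklore] **THE ONE-STEP STRUCTURE AFTER `ι`** (the NE5 owner's displayed `hstruct : R k μ i = C * lprod (…) L`, AT THE DATUM, in V1's line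
coordinates): `towerOfS P ι (avgTower ℰ V) k ν (e x) = ι (corr ℰ U_j ⟨x,ν⟩) · Π_{t<L} ι (U_j (line ⟨x,ν⟩ t))` with `U_j = avgTower ℰ V j`, `j + 1 = K − k`
(here stated at `x : Site P (P.K − k)` with `P.K − k = j + 1` supplied as the form of the site type by the caller). -/
theorem towerOfS_avgTower_chart_succ (ℰ : LoopAverage G) (V : GaugeField P 0 G) {k j : ℕ} (h : k ≤ P.K) (hj : P.K - k = j + 1) (ν : Fin P.d)
    (x : Site P (P.K - k)) :
    towerOfS P ι (avgTower ℰ V) k ν (siteIdx P (j := P.K - k) (k := k) (by omega) x) =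
      ι (corr ℰ (avgTower ℰ V j) (hj ▸ (⟨x, ν⟩ : PBond P (P.K - k)))) *
        ((List.range P.L).map fun t => ι (avgTower ℰ V j (line (hj ▸ (⟨x, ν⟩ : PBond P (P.K - k))) t))).prod := by
  rw [towerOfS_chart ι _ h]
  -- transport the bond along `P.K - k = j + 1`
  have key : ∀ (m : ℕ) (hm : m = j + 1) (b : PBond P m),
      ι (avgTower ℰ V m b) = ι (corr ℰ (avgTower ℰ V j) (hm ▸ b)) * ((List.range P.L).map fun t => ι (avgTower ℰ V j (line (hm ▸ b) t))).prod := by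
    intro m hm b
    subst hm
    rw [avgTower_succ, map_mul, iota_pathProd_eq_list_prod]
  exact key _ hj ⟨x, ν⟩

end Scalar

/-! ## §4 The plumbing of the four letters into NE5's binders `hreg` ∕ `hloc` -/

section Plumbing

variable {d : ℕ} (L : ℕ) [NeZero L] (M : Fin d → ℕ) [hM : ∀ μ, NeZero (M μ)] {o : Type*} [Fintype o] [DecidableEq o]

/-- [folklore] **(S3) THE PLUMBING, GENERIC IN THE SCALAR TOWER**: for any family `RgV` of scalar transporter towers over a window `dom`, the per-background
letters (ℓ1) levelwise `RegularTransporters … α β`, (ℓ2) `hlipD` (Lipschitz `βD∕ℓ_k` of the DERIVATIVE tower), (ℓ3) `hbavg` and (ℓ4) `hbavgD` (block-average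
consistency `γ∕ℓ_k` of the connection and derivative towers) give the PAIR of binders `hreg` ∧ `hloc` of g38-c ∕ W-21c TOKEN FOR TOKEN, with
`C := γ + 2d·max β βD` and `θ := L⁻¹` — ONE application of row NE2's `NE2FromNE3BavgBridge.localRate_regClass_of_bavg_consistent` per background.
(ℓ2)(ℓ4) are DISPLAYED: their discharge is row NE2's ROOT-B programme (t4-dagwriter Q49 (b)), not the substrate's. -/
theorem hreg_hloc_of_letters {BgD : Type*} {dom : Set BgD} {RgV : BgD → ((k : ℕ) → Fin d → (Tor (fine (lev L k) M) → Matrix o o ℂ))}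
    {α β βD γ : ℝ} (hβD : 0 ≤ βD)
    (h1 : ∀ V ∈ dom, RegularTransporters L M (liftR L M (RgV V)) α β)
    (h2 : ∀ V ∈ dom, ∀ k μ ν (i : idx L M k),
      ‖dconnTower L M (liftR L M (RgV V)) k μ (tau (fine (lev L k) M) ν i) - dconnTower L M (liftR L M (RgV V)) k μ i‖ ≤ βD / (lev L k : ℕ))
    (h3 : ∀ V ∈ dom, ∀ k μ (y : idx L M k),
      ‖bavg (lev L k) L M (connTower L M (liftR L M (RgV V)) (k + 1) μ) y - connTower L M (liftR L M (RgV V)) k μ y‖ ≤ γ / (lev L k : ℕ))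
    (h4 : ∀ V ∈ dom, ∀ k μ (y : idx L M k),
      ‖bavg (lev L k) L M (dconnTower L M (liftR L M (RgV V)) (k + 1) μ) y - dconnTower L M (liftR L M (RgV V)) k μ y‖ ≤ γ / (lev L k : ℕ)) :
    (∀ V ∈ dom, RegularTransporters L M (liftR L M (RgV V)) α β) ∧
      ∀ V ∈ dom, LocalRate (bgReadings L M (regClass L M (liftR L M (RgV V)))) (γ + 2 * d * max β βD) ((L : ℝ)⁻¹) :=
  ⟨h1, fun V hV => localRate_regClass_of_bavg_consistent L M (h1 V hV) hβD (h2 V hV) (h3 V hV) (h4 V hV)⟩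

end Plumbing

section PlumbingAvg

variable (P : Params) {G : Type*} [GaugeGroup G] {o : Type*} [Fintype o] [DecidableEq o] (ι : G →* Matrix o o ℂ) (ℰ : LoopAverage G)

/-- [folklore] **(S3) AT THE DATUM**: the same plumbing for the scalar AVERAGING towers `RgV b := towerOfS P ι (avgTower ℰ (fld b))` of the finest
configurations `fld b`, `b` in any window `dom : Set BgD` — the `hreg` ∕ `hloc` supplier of the E-avg instance; its (ℓ1)(ℓ3) inputs are W-25b's
conclusions (ON EVENT g39-a), its (ℓ2)(ℓ4) inputs stay hypotheses. -/
theorem hreg_hloc_avgTower {BgD : Type*} {dom : Set BgD} (fld : BgD → GaugeField P 0 G) {α β βD γ : ℝ} (hβD : 0 ≤ βD)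
    (h1 : ∀ b ∈ dom, RegularTransporters P.L (unitMod P) (liftR P.L (unitMod P) (towerOfS P ι (avgTower ℰ (fld b)))) α β)
    (h2 : ∀ b ∈ dom, ∀ k μ ν (i : idx P.L (unitMod P) k),
      ‖dconnTower P.L (unitMod P) (liftR P.L (unitMod P) (towerOfS P ι (avgTower ℰ (fld b)))) k μ (tau (fine (lev P.L k) (unitMod P)) ν i)
        - dconnTower P.L (unitMod P) (liftR P.L (unitMod P) (towerOfS P ι (avgTower ℰ (fld b)))) k μ i‖ ≤ βD / (lev P.L k : ℕ))
    (h3 : ∀ b ∈ dom, ∀ k μ (y : idx P.L (unitMod P) k),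
      ‖bavg (lev P.L k) P.L (unitMod P) (connTower P.L (unitMod P) (liftR P.L (unitMod P) (towerOfS P ι (avgTower ℰ (fld b)))) (k + 1) μ) y
        - connTower P.L (unitMod P) (liftR P.L (unitMod P) (towerOfS P ι (avgTower ℰ (fld b)))) k μ y‖ ≤ γ / (lev P.L k : ℕ))
    (h4 : ∀ b ∈ dom, ∀ k μ (y : idx P.L (unitMod P) k),
      ‖bavg (lev P.L k) P.L (unitMod P) (dconnTower P.L (unitMod P) (liftR P.L (unitMod P) (towerOfS P ι (avgTower ℰ (fld b)))) (k + 1) μ) y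
        - dconnTower P.L (unitMod P) (liftR P.L (unitMod P) (towerOfS P ι (avgTower ℰ (fld b)))) k μ y‖ ≤ γ / (lev P.L k : ℕ)) :
    (∀ b ∈ dom, RegularTransporters P.L (unitMod P) (liftR P.L (unitMod P) (towerOfS P ι (avgTower ℰ (fld b)))) α β) ∧
      ∀ b ∈ dom, LocalRate (bgReadings P.L (unitMod P) (regClass P.L (unitMod P) (liftR P.L (unitMod P) (towerOfS P ι (avgTower ℰ (fld b))))))
        (γ + 2 * P.d * max β βD) ((P.L : ℝ)⁻¹) :=
  hreg_hloc_of_letters P.L (unitMod P) (RgV := fun b => towerOfS P ι (avgTower ℰ (fld b))) hβD h1 h2 h3 h4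

end PlumbingAvg

/-! ## §5 The TOP-LEVEL CAVEAT (located junction fact): at a `towerOf`-padded tower the `∀ k` letters (ℓ3)(ℓ4) ∕ `hloc` compare the finest
connection with the junk level `K + 1` and force the finest field within `O(L^{−2K})` of `1` — the letters are consumable only on a level WINDOW -/

section TopLevel

variable (P : Params) {G : Type*} [GaugeGroup G] {o : Type*} [Fintype o] [DecidableEq o] (ι : G →* Matrix o o ℂ)

/-- [folklore] the connection tower of a padded `towerOf` VANISHES beyond `K`. -/
theorem connTower_towerOf_of_lt (U : (j : ℕ) → GaugeField P j G) {k : ℕ} (hk : P.K < k) (ν : Fin P.d) (i : idx P.L (unitMod P) k) :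
    connTower P.L (unitMod P) (towerOf P ι U) k ν i = 0 := by
  rw [connTower_eq, towerOf_of_lt ι U hk, sub_self, smul_zero]

/-- [folklore] at the top level the connection tower IS `L^K(ι V − 1)` of the finest configuration, in the chart. -/
theorem norm_connTower_towerOf_top (U : (j : ℕ) → GaugeField P j G) (ν μ : Fin P.d) (x : Site P (P.K - P.K)) :
    ‖connTower P.L (unitMod P) (towerOf P ι U) P.K ν (siteIdx P (j := P.K - P.K) (k := P.K) (by omega) x, μ)‖
      = (P.L : ℝ) ^ P.K * ‖ι (U (P.K - P.K) ⟨x, ν⟩) - 1‖ := by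
  rw [connTower_eq, towerOf_chart ι U le_rfl, norm_smul, norm_lev]

/-- [folklore] **(ℓ3) AT THE TOP LEVEL FORCES A TINY FINEST CONNECTION**: the displayed letter `hbavg` at `k = K` reads `‖0 − w_K(y)‖ ≤ γ∕L^K`. -/
theorem norm_connTower_top_le_of_hbavg (U : (j : ℕ) → GaugeField P j G) {γ : ℝ}
    (hbavg : ∀ k μ (y : idx P.L (unitMod P) k),
      ‖bavg (lev P.L k) P.L (unitMod P) (connTower P.L (unitMod P) (towerOf P ι U) (k + 1) μ) y
        - connTower P.L (unitMod P) (towerOf P ι U) k μ y‖ ≤ γ / (lev P.L k : ℕ))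
    (μ : Fin P.d) (y : idx P.L (unitMod P) P.K) : ‖connTower P.L (unitMod P) (towerOf P ι U) P.K μ y‖ ≤ γ / (lev P.L P.K : ℕ) := by
  have h := hbavg P.K μ y
  have h0 : bavg (lev P.L P.K) P.L (unitMod P) (connTower P.L (unitMod P) (towerOf P ι U) (P.K + 1) μ) y = 0 := by
    unfold bavg
    simp only [connTower_towerOf_of_lt P ι U (Nat.lt_succ_self _), Finset.sum_const_zero, smul_zero]
  rwa [h0, zero_sub, norm_neg] at h

/-- [folklore] **ROW NE2's BINDER `hloc` AT A PADDED TOWER FORCES A TINY FINEST CONNECTION**: `LocalRate (bgReadings 𝒟) C L⁻¹` with `connTower (towerOf U) ∈ 𝒟`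
gives `‖w_K(parT x′)‖ ≤ 2|o|C∕L^K` at every parent index (NE2's `consistent_of_localRate_lev` at `k = K`, where level `K+1` reads `0`). -/
theorem norm_connTower_top_le_of_localRate {𝒟 : Set ((k : ℕ) → Fin P.d → (idx P.L (unitMod P) k → Matrix o o ℂ))} {C : ℝ} (hC : 0 ≤ C)
    (h : LocalRate (bgReadings P.L (unitMod P) 𝒟) C ((P.L : ℝ)⁻¹)) (U : (j : ℕ) → GaugeField P j G)
    (hW : connTower P.L (unitMod P) (towerOf P ι U) ∈ 𝒟) (ν : Fin P.d) (x' : idx P.L (unitMod P) (P.K + 1)) :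
    ‖connTower P.L (unitMod P) (towerOf P ι U) P.K ν (parT (lev P.L P.K) P.L (unitMod P) x')‖
      ≤ (2 * (Fintype.card o : ℝ) * C) / (lev P.L P.K : ℕ) := by
  have h1 := consistent_of_localRate_lev P.L (unitMod P) hC h hW P.K ν x'
  rwa [connTower_towerOf_of_lt P ι U (Nat.lt_succ_self _), zero_sub, norm_neg] at h1

/-- [folklore] the same at EVERY top-level index (every index is a parent: `parT (cpt i.1 + off 0, i.2) = i`). -/
theorem norm_connTower_top_le_of_localRate' {𝒟 : Set ((k : ℕ) → Fin P.d → (idx P.L (unitMod P) k → Matrix o o ℂ))} {C : ℝ} (hC : 0 ≤ C)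
    (h : LocalRate (bgReadings P.L (unitMod P) 𝒟) C ((P.L : ℝ)⁻¹)) (U : (j : ℕ) → GaugeField P j G)
    (hW : connTower P.L (unitMod P) (towerOf P ι U) ∈ 𝒟) (ν : Fin P.d) (i : idx P.L (unitMod P) P.K) :
    ‖connTower P.L (unitMod P) (towerOf P ι U) P.K ν i‖ ≤ (2 * (Fintype.card o : ℝ) * C) / (lev P.L P.K : ℕ) := by
  obtain ⟨x', hx'⟩ : ∃ x' : idx P.L (unitMod P) (P.K + 1), parT (lev P.L P.K) P.L (unitMod P) x' = i :=
    ⟨(cpt (lev P.L P.K) P.L (unitMod P) i.1 + off (lev P.L P.K) P.L (unitMod P) (fun _ => ⟨0, P.L_pos⟩), i.2), by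
      unfold parT; rw [par_cpt_add_off]⟩
  subst hx'
  exact norm_connTower_top_le_of_localRate P ι hC h U hW ν x'

/-- [folklore] **THE V1 READING**: `hloc` at the class `regClass (towerOf P ι U)` (NE5's binder shape at `liftR (RgV V) = towerOf …`) forces EVERY finest bond variable
to satisfy `L^K·‖ι (U₀ b) − 1‖ ≤ 2|o|C∕L^K` — the finest field within `2|o|C·L^{−2K}` of `1` (after `ι`). -/
theorem finest_small_of_hloc {C : ℝ} (hC : 0 ≤ C) (U : (j : ℕ) → GaugeField P j G)
    (hloc : LocalRate (bgReadings P.L (unitMod P) (regClass P.L (unitMod P) (towerOf P ι U))) C ((P.L : ℝ)⁻¹))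
    (x : Site P (P.K - P.K)) (ν : Fin P.d) :
    (P.L : ℝ) ^ P.K * ‖ι (U (P.K - P.K) ⟨x, ν⟩) - 1‖ ≤ (2 * (Fintype.card o : ℝ) * C) / (P.L : ℝ) ^ P.K := by
  have h := norm_connTower_top_le_of_localRate' P ι hC hloc U (by simp [regClass]) ν (siteIdx P (j := P.K - P.K) (k := P.K) (by omega) x, ν)
  rwa [norm_connTower_towerOf_top, cast_lev'] at h

end TopLevel

end Summit.QuantumFields.BalabanUV.T4Continuum.SubstrateAvgTowerPlumbing

end
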